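import Summits.QuantumAdvantage.QuantumAdvantage.Theorems.CharDialColumnDialD
import Summits.QuantumAdvantage.AdviceFreeQNC0.TensorMultZero
import HarnessLib

/-!
# PartyDial — decomp-qadv lens-5 g35 node on `CharDial.FrobHardOdd` (stmt-QuantumAdvantage-32598): the BLOCK-LOCAL (k-party Bell)
# LAWS of the `ℤ₃`-walk game — two blocks `8/9`, four blocks `2/3` (optimal), every `n`, no degree hypothesis

Lens «finite/base range + asymptotic regime + bridge», RESIDUAL MODE (g34 left `FrobHardOdd ⟺ AsymFrobOdd`, its symmetric-block law
needing WEIGHT-SYMMETRIC blocks).  This node decides the complementary LOCALITY sector, with ARBITRARY computation inside the blocks.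

THE DIAL = the number `k` of BLOCKS of a block-local strategy: the positions are split into `k` runs (`bl : Fin n → ℕ`), every cut `g`
belongs to a party `pty g`, reads ONLY the bits of block `pty g` (`BlockLocal`), all blocks `< pty g` lie before the cut and all blocks
`> pty g` after it (`IsBlockLocal k m₀`, blocks of length `≥ m₀`).  Inside its block a party computes ANY Boolean functions (no degree, no
junta, no symmetry hypothesis) and fires any set of cuts; charges are per cut (`ringWinE e`; `e g = c + g` is the route's `ringWinU c`).

THE MECHANISM (§2, proved).  For a cut of party `j` the walk address is `e_g + locA_j(u) + Φ_j(w)` with `locA_j` block-`j`-local and the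
EXTERNAL PHASE `Φ_j(w) = 2·Σ_{i<j} w_i + Σ_{i>j} w_i` a function of the CELL `w = (weight of block i mod 3)_i ∈ (ℤ/3)^k` alone
(`addr_decomp`: earlier blocks are walked twice, later blocks once).  So party `j` contributes to the win parity its REGISTER parity
`reg_j(u, φ) mod 2` read at `φ = Φ_j(w)`, and the three register counts have EVEN SUM (`reg_sum_even`: a fired cut is non-zero at exactly
two of the three phases).  Hence a party's behaviour at `u` is one of FOUR ACTIONS (`pat`/`encB`: PASS, or FIRE with dead phase
`a ∈ ℤ/3`), itself block-local (`blockLocal_pat`), and `WIN(u) = tabWin(cell(u), patterns(u))` (`ringWinE_eq_tabWin`).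
THE BRIDGE (§1, proved).  Own-class events of different blocks are independent under the uniform input (`indep_count`, from the tree's
sum-code overwrite involution `SumCodeZero.sum_card_filter_ovr`), so DERANDOMISING the block-local patterns party by party inside each
own-class (`derand_step`, `derand`, `Finset.exists_min_image`) never enlarges the LOSE set and ends in a profile of CLASS-TABLES
`t_j : ℤ/3 → Fin 4`; counting cells gives `pattern_law`: `#LOSE ≥ (3^k − N)·(Π_j γ_j)·2ⁿ` whenever every class-table profile wins `≤ N`
cells and `γ_j·2ⁿ ≤` every class size (`γ(m₀) = (1 − 2/2^{m₀})/3`, tree `SumCodeZero.gamma_mul_le_card_cls`).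
THE FINITE RANGE (§0, kernel).  `N(2) = 8` of `9` cells (`nWins_two_le`, sharp: `nWins_two_sharp`); `N(4) = 54` of `81`
(`nWins_four_le_of` from the closed decidable `Prop` `Best4Le` over `Fin 64³` base-4-coded tables with the last party best-responding
(`best4`); `Best4Le` is PROVED in §4 (`best4Le`) by `native_decide` on a MEMOISED evaluator (`tab4`/`best4T`/`check4`, ≈ 80 s of farm
interpreter; the plain evaluation `PartyDialFourCheck.best4Le_slow` costs ≈ 20 min and stays outside), whence `nWins_four_le`
unconditionally; sharp: `nWins_four_sharp`).  Exact values `8/9, 20/27, 2/3` for `k = 2, 3, 4` (memo); `2/3` is OPTIMAL (one blind cut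
wins `2/3`), so four independent blocks already erase every advantage of computation.
THE LAWS (§3, proved).  `block_law` (general `k, N, m₀`); `twoBlockLaw`: every 2-block-local strategy wins on `≤ (1 − γ(m₀)²)·2ⁿ`
(`→ 8/9`); `fourBlockLaw` (hypothesis `Best4Le`) / `fourBlockLaw'` (§4, unconditional): every 4-block-local strategy wins on
`≤ (1 − 27·γ(m₀)⁴)·2ⁿ` (`→ 2/3`).

PIECES of `T = CharDial.FrobHardOdd` (tags in the docstrings; probes in `bc/Probes.lean`):
* `TwoBlockFrobOdd` (A) — `T` on 2-block-local degree-`(p−1)` strategies (blocks `≥ 6`): PROVED for every `n` with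
  `θ = 1 − γ(6)² = 1 − (31/96)²`, the degree hypothesis unused (`twoBlockFrobOdd_holds`); strictly WEAKER than `T` (probe MF2).
* `CrossingFrobOdd` (B) — `T` on strategies that are NOT 2-block-local (some cut straddles every admissible split): T-implied
  (`crossingFrobOdd_of_frobHardOdd`), UNDECIDED, and `T ⟺ (B)` BY NAME (`frobHardOdd_iff_crossing`) — the decided-dial shape.
§5 FREE ZONES (the lens's BRIDGE made a theorem).  Declare any set `B` of coordinates FREE (readable by every cut); if the
remaining coordinates split into `k` segments of `≥ m₀` in line order with cut `g` reading, outside `B`, only segment `pty g`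
(segments `< pty g` before it, `> pty g` after it) — a `k`-SEPARATED strategy, `IsSepLocal` — then fixing the free bits and
re-indexing the active coordinates (`act`/`emb`/`glue`, `walkExp_glue`, `ringWinU_glue`) turns each fibre into the GENERAL game of
§2 (cuts `Fin (n+1)` at reduced positions `posA`, charges shifted by the free bits), which is `k`-block-local: the block law holds
fibre by fibre and sums to `sep_law` (same constants as `block_law`).  Radius-`r` WINDOW strategies (cut `g` reads only
`u_{g−r} … u_{g+r−1}`: `WindowLocal`) are 2-separated for `n ≥ 2m₀ + 2r − 1` and 4-separated for `n ≥ 4m₀ + 3(2r − 1)`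
(buffers of `2r − 1` free bits): `windowLaw_two` (`8/9`), `windowLaw_four` (`2/3`).  PIECES: `SepFrobOdd` (T on 2-separated
strategies, segments `≥ 2`) and `WindowFrobOdd` (T on window strategies, every radius `r ≤ (n−3)/2`) are PROVED with `θ = 35/36`;
the residual is `EntangledFrobOdd` (T on strategies admitting NO free zone / two separated pairs split of their reads) and
★ `frobHardOdd_iff_entangled : FrobHardOdd ⟺ EntangledFrobOdd`; the §3 residual class shrinks
(`isSepLocal_two_two_of_isBlockLocal`, `crossingFrobOdd_of_entangled`).

§6 PAIR SEPARATION (cuts ANYWHERE) and the FAN-IN sector.  For two parties the line-order condition is unnecessary: a cut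
reading one segment may sit anywhere provided it does not SPLIT the other segment (phase coefficient `2` if that segment is
before it, `1` if after); each cut's firing set is still an even function of the foreign class, so each party's pattern is
one of the four `hit a` and the two-party bound `8/9` applies verbatim (`pair_law_core`, `pair_law` via `law_of_fibres`;
`IsPairLocal`).  By counting, every strategy of FAN-IN `≤ ℓ` with `8(ℓ+1)² ≤ n` is pair-separated (two disjoint adjacent
pairs whose readers do not interfere: `isPairLocal_of_fanIn`), whence ★ `fanInLaw` (`35/36`, any wiring, any positions) and
the pieces `PairFrobOdd`, `FanInFrobOdd`, `LocalFrobOdd ℓ` (constant fan-in, the `NC⁰`-reading form of T) — all PROVED,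
degree-free; residual `KnottedFrobOdd` (some cut of fan-in `> √(n/8) − 1` in every residual strategy: the first residual
on which the degree hypothesis must bite) with ★ `frobHardOdd_iff_knotted`, `knottedFrobOdd_of_entangled`.

§7 THE PARITY LAW (`k` blind pairs, cuts anywhere) and the fan-in sector up to `n^{1-1/k}`.  For segments of size TWO
no table game and no derandomisation are needed: restrict each of `k` disjoint pairs to the CANONICAL patterns `00, 01, 11`
(one per class of `ℤ/3`), everything else fixed — a grid of `3^k` inputs; a cut BLIND to a pair and not splitting it sees the
pair's weight with a unit coefficient, so it fires at `0` or `2` points of every line of the grid in that direction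
(`fire_count_pair`), every cut fires evenly on the grid, and `3^k` wins would be an odd total (`blind_grid_loser`): one loser
per fibre, ★ `blind_law` `≤ (1 − 4^{-k})·2ⁿ` for `k`-BLIND strategies (`IsBlind k`: every cut blind to and non-splitting
for one of the `k` pairs — what else it reads is unrestricted).  Counting over `k` ranges of adjacent pairs
(`isBlind_of_fanIn`): fan-in `ℓ` with `(n+1)(ℓ+1)^k < (n/2k)^k` ⟹ `k`-blind, whence ★★ `fanInLawK` (every `k`; `ℓ` up to
`≈ n^{1−1/k}/2k`), pieces `BlindFrobOdd k`, `PolyFanInFrobOdd k` PROVED (degree-free), residual `DeepFrobOdd k` with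
★ `frobHardOdd_iff_deep k` (every `k`), nesting `isBlind_of_isPairLocal`, `deepFrobOdd_two_of_knotted`.

§8 THE HYBRID LAW — the first rung that USES the degree hypothesis.  One cut `g₀` arbitrary of `𝔽_p`-degree `≤ D`, the
rest `k`-blind (`IsBlindExcept g₀ k`): on the grid of §7 the blind cuts fire evenly, so all `3^k` points win only if `g₀`
fires an ODD number of times; its address splits as free part + pair part (`walkExp_fill`), for every answer pattern `φ` of
`g₀` on the grid ONE residue of the free part makes its count even (`exists_even_residue`: the three counts sum to `2·#φ`),
the pattern events `{t : y_{g₀}(fill t ·) = φ}` have `𝔽_p`-degree `≤ 3^k·D` (`hasDegF_pattern`, via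
`Smolensky.mul_mem_lowDeg_add` / `comp_subst_mem_lowDeg`), and the NAMED ANALYTIC HYPOTHESIS `LowDegIndep3At p (3^k D) ε m₀`
(a bounded-degree Boolean is `ε`-independent of the residue mod 3 of a form with `≥ m₀` unit coefficients — exponential
sums for polynomials over `ℤ_p` vs `MOD_3`, Bourgain 2005 / Green–Roy–Straubing 2005 / Chattopadhyay 2006; FALSE at `p = 3`,
as `¬ WalkHardF 3` demands; NOT proved here, NOT in the tree) gives `≥ 2ⁿ/4` free assignments with a grid loser, each loser
from `≤ 4^k` of them: ★★ `hybrid_law` `≤ (1 − 4^{-(k+1)})·2ⁿ` GIVEN the fact; selection from fan-in-except-`g₀`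
(`isBlindExcept_of_fanInExcept`), ★★ `hybridFanInLaw`; pieces `OneDenseFrobOdd k` / `OneDenseFanInFrobOdd k` PROVED GIVEN
`LDI3 k`; residual `TwoDeepFrobOdd k` («at least two deep cuts») with ★ `frobHardOdd_iff_twoDeep k (hF : LDI3 k)`,
`twoDeepFrobOdd_of_deep`.  Degree is NECESSARY here: with an unrestricted exceptional cut two cuts win with probability 1
(`hybrid_needs_degree`, §8e).  §8f–g ANY FINITE NUMBER `w` OF DENSE CUTS, same hypothesis shape, SAME `θ`: CONDITION on
every free coordinate outside one window `[G₁, G₂)` free of the dense cuts (`ovr`, `gapF/gapX`); for a cut outside the window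
the address is `c_g·σ(t) + (t-independent)` with `c_g ∈ {1,2}` and `σ` = the number of ones in the window (`walkExp_cond`),
ONE residue of `σ` makes the TOTAL count of the `w` cuts even (`exists_even_residue_multi`), the blind cuts fire evenly
(`grid_loser_multi`), the fact is applied ONCE per conditioning to the pattern TUPLE (degree `≤ w·3^k·D`) and the form `σ`,
and losers for different conditionings are different inputs (`multi_cond`, ★★★ `multi_law_core` / `multi_law`
`≤ (1 − 4^{-(k+1)})·2ⁿ`); `≤ w` cuts leave a free window of length `n/(w+1)` (`exists_free_window`); pieces
`MultiDenseFrobOdd w k` / `MultiDenseFanInFrobOdd w k` PROVED GIVEN `LDI3W w k` (`LDI3W 1 k ↔ LDI3 k`, `ldi3W_anti`); residual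
`ManyDeepFrobOdd w k` («more than `w` deep cuts»), monotone in `w`, with ★ `frobHardOdd_iff_manyDeep w k (hF : LDI3W w k)`,
`manyDeepFrobOdd_of_twoDeep`.

No `sorry`, no instances, no notation; in the TREE parts the §0 finite checks run by `decide +kernel` (k = 2 tables, k = 4 sharpness instance;
the node's `native_decide` forms are byte-identical statements);
§4: the memoised k = 4 check, ≈ 80 s; §4/§5d are NODE-ONLY — the tree twins take `(hB : Best4Le)`).  One more Literature
module is imported than in g34 (`SmolenskyCorrelationRestrict`, for §8/§8f).  Memo `NODE-g35.md` (g35 folder of decomp-qadv-lens-5).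
-/

set_option autoImplicit false
set_option linter.dupNamespace false

namespace Summit.QuantumAdvantage.QuantumAdvantage.Theorems.PartyDial

open Finset
open Summit.QuantumAdvantage.AdviceFreeQNC0

/-! ## §0  The table game on `(ℤ/3)^k` and its values (finite range, kernel-checked) -/

section TableGame

/-- An ACTION of one party inside one own-class: `a < 3` = FIRE with dead phase `a` (the party's
register is odd at every external phase `φ ≠ a`); `a = 3` = PASS (register even at every phase). -/
def hit (a : Fin 4) (φ : ZMod 3) : Bool := decide (a.val < 3 ∧ φ ≠ (a.val : ZMod 3))

/-- The external phase seen by party `j` in the cell `w ∈ (ℤ/3)^k`: `Φ_j(w) = 2·Σ_{i<j} w_i + Σ_{i>j} w_i`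
(past blocks are read twice by the walk, future blocks once). -/
def phase {k : ℕ} (w : Fin k → ZMod 3) (j : Fin k) : ZMod 3 :=
  ∑ i : Fin k, if i < j then 2 * w i else if j < i then w i else 0

/-- WIN bit of the table game in cell `w` under the action profile `a`: an odd number of hits. -/
def tabWin {k : ℕ} (w : Fin k → ZMod 3) (a : Fin k → Fin 4) : Bool :=
  decide ((∑ j : Fin k, (if hit (a j) (phase w j) = true then (1 : ZMod 2) else 0)) = 1)

/-- Number of winning cells of a profile of CLASS-TABLES `t j : ZMod 3 → Fin 4` (party `j` reads only
its own class `w_j`). -/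
def nWins {k : ℕ} (t : Fin k → ZMod 3 → Fin 4) : ℕ :=
  (univ.filter fun w : Fin k → ZMod 3 => tabWin w (fun j => t j (w j)) = true).card

/-- **Two parties: at most `8` of the `9` cells** (value `8/9`). -/
theorem nWins_two_le : ∀ t : Fin 2 → ZMod 3 → Fin 4, nWins t ≤ 8 := by decide +kernel

/-- … and `8` is attained. -/
theorem nWins_two_sharp : ∃ t : Fin 2 → ZMod 3 → Fin 4, nWins t = 8 :=
  ⟨![fun _ => 0, fun r => if r = 0 then 0 else 3], by decide +kernel⟩

/-! ### Four parties, efficiently: base-4 coded tables and the last party's best response -/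

/-- base-`4` digit decoding of a class-table code `s < 64`: the action in own-class `r`. -/
def dig (s : Fin 64) (r : ZMod 3) : Fin 4 := ⟨s.val / 4 ^ r.val % 4, Nat.mod_lt _ (by norm_num)⟩

/-- base-`4` coding of a class-table. -/
def enc (f : ZMod 3 → Fin 4) : Fin 64 := ⟨(f 0).val + 4 * (f 1).val + 16 * (f 2).val, by omega⟩

/-- decoding inverts coding. -/
theorem dig_enc (f : ZMod 3 → Fin 4) (r : ZMod 3) : dig (enc f) r = f r := by
  have h0 := (f 0).isLt
  have h1 := (f 1).isLt
  have h2 := (f 2).isLt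
  fin_cases r
  · apply Fin.ext; simp [dig, enc, ZMod.val]; omega
  · apply Fin.ext; simp [dig, enc, ZMod.val]; omega
  · apply Fin.ext; simp [dig, enc, ZMod.val]; omega

/-- the four-party WIN bit with the phases spelled out. -/
def win4 (w0 w1 w2 w3 : ZMod 3) (a0 a1 a2 a3 : Fin 4) : Bool :=
  xor (hit a0 (w1 + w2 + w3)) (xor (hit a1 (2 * w0 + w2 + w3))
    (xor (hit a2 (2 * w0 + 2 * w1 + w3)) (hit a3 (2 * w0 + 2 * w1 + 2 * w2))))

/-- wins among the `27` cells with `w₃ = x` when parties `0,1,2` play the coded tables `s_i` and party `3`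
plays the action `a`. -/
def slab4 (s0 s1 s2 : Fin 64) (x : ZMod 3) (a : Fin 4) : ℕ :=
  ∑ w0 : ZMod 3, ∑ w1 : ZMod 3, ∑ w2 : ZMod 3,
    if win4 w0 w1 w2 x (dig s0 w0) (dig s1 w1) (dig s2 w2) a = true then 1 else 0

/-- party `3`'s best response, slab by slab. -/
def best4 (s0 s1 s2 : Fin 64) : ℕ := ∑ x : ZMod 3, univ.sup fun a : Fin 4 => slab4 s0 s1 s2 x a

/-- **The kernel check** (as a `Prop`; PROVED in §4 `best4Le` by `native_decide` on the memoised evaluator;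
the plain `native_decide` of `PartyDialFourCheck.lean` takes ≈ 20 min): against every three coded tables,
party `3`'s best response wins `≤ 54` cells. -/
def Best4Le : Prop := ∀ s0 s1 s2 : Fin 64, best4 s0 s1 s2 ≤ 54

/-- the external phase of party `0` of four. -/
theorem phase_four_0 (w : Fin 4 → ZMod 3) : phase w 0 = w 1 + w 2 + w 3 := by
  simp [phase, Fin.sum_univ_four, add_assoc]
/-- the external phase of party `1` of four. -/
theorem phase_four_1 (w : Fin 4 → ZMod 3) : phase w 1 = 2 * w 0 + w 2 + w 3 := by
  simp [phase, Fin.sum_univ_four, add_assoc]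
/-- the external phase of party `2` of four. -/
theorem phase_four_2 (w : Fin 4 → ZMod 3) : phase w 2 = 2 * w 0 + 2 * w 1 + w 3 := by
  simp [phase, Fin.sum_univ_four]
/-- the external phase of party `3` of four. -/
theorem phase_four_3 (w : Fin 4 → ZMod 3) : phase w 3 = 2 * w 0 + 2 * w 1 + 2 * w 2 := by
  simp [phase, Fin.sum_univ_four]

/-- the four-party WIN bit in the `ℕ`-coded form used by the evaluator `win4`. -/
theorem tabWin_four (w : Fin 4 → ZMod 3) (a : Fin 4 → Fin 4) :
    tabWin w a = win4 (w 0) (w 1) (w 2) (w 3) (a 0) (a 1) (a 2) (a 3) := by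
  unfold tabWin win4
  rw [Fin.sum_univ_four, phase_four_0, phase_four_1, phase_four_2, phase_four_3]
  generalize hit (a 0) (w 1 + w 2 + w 3) = b0
  generalize hit (a 1) (2 * w 0 + w 2 + w 3) = b1
  generalize hit (a 2) (2 * w 0 + 2 * w 1 + w 3) = b2
  generalize hit (a 3) (2 * w 0 + 2 * w 1 + 2 * w 2) = b3
  cases b0 <;> cases b1 <;> cases b2 <;> cases b3 <;> decide

/-- `(ℤ/3)^4` as a fourfold product (for reindexing sums). -/
def pi4Equiv : (Fin 4 → ZMod 3) ≃ ZMod 3 × ZMod 3 × ZMod 3 × ZMod 3 where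
  toFun w := (w 3, w 0, w 1, w 2)
  invFun q i := if i = 0 then q.2.1 else if i = 1 then q.2.2.1 else if i = 2 then q.2.2.2 else q.1
  left_inv w := by funext i; fin_cases i <;> simp
  right_inv q := by simp

/-- **Four parties: at most `54` of the `81` cells** (value `2/3`), from the kernel check. -/
theorem nWins_four_le_of (hB : Best4Le) (t : Fin 4 → ZMod 3 → Fin 4) : nWins t ≤ 54 := by
  have hmain := hB (enc (t 0)) (enc (t 1)) (enc (t 2))
  set F : ZMod 3 × ZMod 3 × ZMod 3 × ZMod 3 → ℕ := fun q =>
    if win4 q.2.1 q.2.2.1 q.2.2.2 q.1 (t 0 q.2.1) (t 1 q.2.2.1) (t 2 q.2.2.2) (t 3 q.1) = true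
    then 1 else 0 with hF
  have hfg : ∀ w : Fin 4 → ZMod 3,
      (if tabWin w (fun j => t j (w j)) = true then 1 else 0) = F (pi4Equiv w) := by
    intro w
    rw [hF, tabWin_four]
    rfl
  have hre : nWins t = ∑ x : ZMod 3, slab4 (enc (t 0)) (enc (t 1)) (enc (t 2)) x (t 3 x) := by
    unfold nWins
    rw [card_filter, Fintype.sum_equiv pi4Equiv _ F hfg, Fintype.sum_prod_type]
    refine Finset.sum_congr rfl fun x _ => ?_
    unfold slab4
    rw [Fintype.sum_prod_type]
    refine Finset.sum_congr rfl fun w0 _ => ?_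
    rw [Fintype.sum_prod_type]
    refine Finset.sum_congr rfl fun w1 _ => ?_
    refine Finset.sum_congr rfl fun w2 _ => ?_
    simp only [hF, dig_enc]
  rw [hre]
  refine le_trans (Finset.sum_le_sum fun x _ => ?_) hmain
  exact Finset.le_sup (f := fun a : Fin 4 => slab4 (enc (t 0)) (enc (t 1)) (enc (t 2)) x a) (mem_univ _)

/-- … and `54` is attained (one party fires blindly). -/
theorem nWins_four_sharp : ∃ t : Fin 4 → ZMod 3 → Fin 4, nWins t = 54 := by
  refine ⟨![fun _ => 0, fun _ => 3, fun _ => 3, fun _ => 3], ?_⟩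
  decide +kernel

end TableGame

end Summit.QuantumAdvantage.QuantumAdvantage.Theorems.PartyDial
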